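import Summits.HodgeConjecture.HodgeConjecture.Theorems.EightfoldBlochSeedsChernCharacterOnBettiAnalytificationVectorBundle
import HarnessLib

/-!
# K1 (analytification bridge), step K1g: the trivial bundle `𝒪_X^I` — every analytification datum is
# a trivial topological bundle; `cᵢ = 0`, `ch_k = 0` (`k ≥ 1`), `ch₀ = #I`

Route `EightfoldBlochSeeds` / item `stmt-HodgeConjecture-19780` (`ChernCharacterOnBetti`), helper
(`--supports`). HONEST FRAMING: nothing here proves 19780 / 18880 / 18882 / 18883 / H2 / HC_AV / HC;
no definition, no named fact.

WHAT. The fields `ch_free_zero` / `ch_free_of_pos` of `ChernCharacterBetti` (normalisation on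
Mathlib's `SheafOfModules.free I`, `I` finite). The Literature lemma
`HodgeTheory.exists_isSectionFrame_top_free` (new) gives `𝒪_X^I` a GLOBAL algebraic frame of size `#I`;
a comparison datum `(E, α)` carries it to a continuous global frame of `E` on `X(ℂ)`, so `E` is a
trivial bundle (Milnor–Stasheff Thm. 2.2, `FramedBundleTrivial`). For `X` smooth projective:

* `frameSize_eq_card_of_comparison_free` — the frame size `r` of any datum of `𝒪_X^I` is `#I`;
* `nonempty_iso_trivial_of_comparison_free` — `E ≅ X(ℂ) × ℂ^r`;
* `chernClassZ_eq_zero_of_comparison_free` (`cᵢ(E) = 0`, `i ≥ 1`),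
  `topologicalChernCharacter_eq_zero_of_comparison_free` (`ch_k(E) = 0`, `k ≥ 1`),
  `topologicalChernCharacter_zero_of_comparison_free` (`ch₀(E) = #I · 1`);
* `exists_analytification_free` — packaged with the existence of a datum (K1d).

[cite: MilnorStasheff1974, §2 Thm. 2.2] [cite: HusemollerFibreBundles1994, Ch. 17 Prop. 4.1]
[cite: Hirzebruch1966, §10.1] [cite: SerreGAGA1956, §3 n°9 Déf. 2]
-/

noncomputable section

-- single-problem summit (Problem = Summit): the mandated namespace repeats `HodgeConjecture`.
set_option linter.dupNamespace false

open CategoryTheory AlgebraicGeometry Bundle Topology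
open Literature.AlgebraicGeometry.Motives Literature.AlgebraicGeometry.HodgeTheory
open Literature.AlgebraicTopology.SingularHomology Literature.AlgebraicTopology.CharacteristicClasses

namespace Summit.HodgeConjecture.HodgeConjecture.Theorems

variable {n : ℕ} {X : SchemeOver ℂ} {I : Type} [Fintype I] {r : ℕ}

/-- **The frames of `𝒪_X^I` have size `#I`** on an irreducible `X`: compare any frame at a point with
the global frame (`frame_card_eq`). [cite: SerreFAC1955, n°41] -/
theorem frameSize_eq_card_of_comparison_free [IrreducibleSpace X.left]
    (hfr : ∀ x : X.left, ∃ (U : X.left.Opens) (s : Fin r → Γ((SheafOfModules.free (R := X.left.ringCatSheaf) I :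
      X.left.Modules), U)), x ∈ U ∧ IsSectionFrame (SheafOfModules.free (R := X.left.ringCatSheaf) I : X.left.Modules) U s) :
    r = Fintype.card I := by
  obtain ⟨x₀⟩ := (inferInstance : Nonempty X.left)
  obtain ⟨s₀, hs₀⟩ := exists_isSectionFrame_top_free X.left I
  obtain ⟨U, s, hx, hs⟩ := hfr x₀
  exact frame_card_eq hs hs₀ hx (Set.mem_univ x₀)

/-- **Every analytification datum of `𝒪_X^I` is a trivial bundle**: the global algebraic frame of
`𝒪_X^I` goes to a continuous global frame of `E`, and a framed bundle is trivial (Milnor–Stasheff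
Thm. 2.2). [cite: MilnorStasheff1974, §2 Thm. 2.2] [cite: SerreGAGA1956, §3 n°9 Déf. 2] -/
theorem nonempty_iso_trivial_of_comparison_free [IrreducibleSpace X.left]
    (E : ComplexVectorBundle.{0, 0} (ComplexPoints X))
    (α : ∀ U : X.left.Opens, Γ((SheafOfModules.free (R := X.left.ringCatSheaf) I : X.left.Modules), U) →
      ∀ P : ComplexPoints X, E.E P)
    (hfr : ∀ x : X.left, ∃ (U : X.left.Opens) (s : Fin r → Γ((SheafOfModules.free (R := X.left.ringCatSheaf) I :
      X.left.Modules), U)), x ∈ U ∧ IsSectionFrame (SheafOfModules.free (R := X.left.ringCatSheaf) I : X.left.Modules) U s)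
    (hcont : ∀ (U : X.left.Opens) (σ : Γ((SheafOfModules.free (R := X.left.ringCatSheaf) I : X.left.Modules), U)),
      ContinuousOn (fun P ↦ (⟨P, α U σ P⟩ : TotalSpace E.F E.E)) {P | P.pt ∈ U})
    (hframe : ∀ (U : X.left.Opens) (t : Fin r → Γ((SheafOfModules.free (R := X.left.ringCatSheaf) I :
      X.left.Modules), U)), IsSectionFrame (SheafOfModules.free (R := X.left.ringCatSheaf) I : X.left.Modules) U t →
      ∀ P : ComplexPoints X, P.pt ∈ U → LinearIndependent ℂ (fun j ↦ α U (t j) P) ∧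
        ⊤ ≤ Submodule.span ℂ (Set.range fun j ↦ α U (t j) P)) :
    Nonempty ((ComplexVectorBundle.trivial (ComplexPoints X) (Fin r → ℂ)).Iso E) := by
  obtain rfl := frameSize_eq_card_of_comparison_free hfr
  obtain ⟨s₀, hs₀⟩ := exists_isSectionFrame_top_free X.left I
  refine ComplexVectorBundle.nonempty_iso_trivial_of_frame E (fun j P ↦ α ⊤ (s₀ j) P) (fun j ↦ ?_)
    (fun P ↦ hframe ⊤ s₀ hs₀ P trivial)
  have h := hcont ⊤ (s₀ j)
  have huniv : {P : ComplexPoints X | P.pt ∈ (⊤ : X.left.Opens)} = Set.univ := Set.eq_univ_of_forall fun _ ↦ trivial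
  rw [huniv, continuousOn_univ] at h
  exact h

variable (hX : IsSmoothProjective n X) (E : ComplexVectorBundle.{0, 0} (ComplexPoints X))
    (α : ∀ U : X.left.Opens, Γ((SheafOfModules.free (R := X.left.ringCatSheaf) I : X.left.Modules), U) →
      ∀ P : ComplexPoints X, E.E P)
    (hrank : E.rank = r)
    (hfr : ∀ x : X.left, ∃ (U : X.left.Opens) (s : Fin r → Γ((SheafOfModules.free (R := X.left.ringCatSheaf) I :
      X.left.Modules), U)), x ∈ U ∧ IsSectionFrame (SheafOfModules.free (R := X.left.ringCatSheaf) I : X.left.Modules) U s)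
    (hcont : ∀ (U : X.left.Opens) (σ : Γ((SheafOfModules.free (R := X.left.ringCatSheaf) I : X.left.Modules), U)),
      ContinuousOn (fun P ↦ (⟨P, α U σ P⟩ : TotalSpace E.F E.E)) {P | P.pt ∈ U})
    (hframe : ∀ (U : X.left.Opens) (t : Fin r → Γ((SheafOfModules.free (R := X.left.ringCatSheaf) I :
      X.left.Modules), U)), IsSectionFrame (SheafOfModules.free (R := X.left.ringCatSheaf) I : X.left.Modules) U t →
      ∀ P : ComplexPoints X, P.pt ∈ U → LinearIndependent ℂ (fun j ↦ α U (t j) P) ∧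
        ⊤ ≤ Submodule.span ℂ (Set.range fun j ↦ α U (t j) P))
include hX hfr hcont hframe

/-- **`cᵢ(E) = 0` for `i ≥ 1`** for every analytification datum `(E, α)` of `𝒪_X^I` on a smooth
projective `X` (a trivial bundle has no positive Chern classes, Husemoller 17 Prop. 4.1).
[cite: HusemollerFibreBundles1994, Ch. 17 Prop. 4.1] [cite: MilnorStasheff1974, §2 Thm. 2.2] -/
theorem chernClassZ_eq_zero_of_comparison_free {i : ℕ} (hi : 0 < i) : chernClassZ E i = 0 := by
  haveI := IsSmoothProjective.isIntegral_holds hX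
  haveI := ComplexPoints.t2Space_of_isSmoothProjective hX
  haveI := paracompactSpace_complexPoints_of_isSmoothProjective hX
  obtain ⟨e⟩ := nonempty_iso_trivial_of_comparison_free E α hfr hcont hframe
  change theChernClassTheory.chernClass E i = 0
  rw [← theChernClassTheory.chernClass_congr e i]
  exact theChernClassTheory.chernClass_trivial (Fin r → ℂ) hi

include hrank

omit hcont hframe in
/-- **`ch₀(E) = #I · 1`** for every analytification datum of `𝒪_X^I` (field `ch_free_zero`: the rank of
the datum is the size `#I` of the algebraic frames). [cite: Hirzebruch1966, §10.1] [cite: SerreFAC1955, n°41] -/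
theorem topologicalChernCharacter_zero_of_comparison_free :
    (theChernClassTheory.topologicalChernCharacter ℂ E 0 : complexBetti X (2 * 0)) =
      (Nat.card I : ℂ) • singularCohomology.one ℂ (ComplexPoints X) := by
  haveI := IsSmoothProjective.isIntegral_holds hX
  rw [theChernClassTheory.topologicalChernCharacter_zero, hrank, frameSize_eq_card_of_comparison_free hfr,
    Nat.card_eq_fintype_card]

/-- **`ch_k(E) = 0` for `k ≥ 1`** for every analytification datum of `𝒪_X^I` (field `ch_free_of_pos`).
[cite: Hirzebruch1966, §10.1] [cite: HusemollerFibreBundles1994, Ch. 17 Prop. 4.1] -/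
theorem topologicalChernCharacter_eq_zero_of_comparison_free {k : ℕ} (hk : 0 < k) :
    (theChernClassTheory.topologicalChernCharacter ℂ E k : complexBetti X (2 * k)) = 0 := by
  haveI := IsSmoothProjective.isIntegral_holds hX
  haveI := ComplexPoints.t2Space_of_isSmoothProjective hX
  haveI := paracompactSpace_complexPoints_of_isSmoothProjective hX
  obtain ⟨e⟩ := nonempty_iso_trivial_of_comparison_free E α hfr hcont hframe
  have hr : (ComplexVectorBundle.trivial (ComplexPoints X) (Fin r → ℂ)).rank = E.rank := by
    rw [ComplexVectorBundle.rank_trivial, Module.finrank_fin_fun, hrank]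
  rw [← theChernClassTheory.topologicalChernCharacter_congr ℂ e hr k]
  exact theChernClassTheory.topologicalChernCharacter_trivial ℂ (Fin r → ℂ) hk

omit hX hfr hcont hframe hrank

/-- **K1g packaged: `𝒪_X^I` on a smooth projective `X` has an analytification datum, of rank `#I`, and
for it (as for any datum) `ch₀ = #I · 1`, `ch_k = 0` (`k ≥ 1`), `cᵢ = 0` (`i ≥ 1`).**
[cite: SerreGAGA1956, §3 n°9 Déf. 2 and §4 n°20] [cite: Hirzebruch1966, §10.1] [cite: HusemollerFibreBundles1994, Ch. 17 Prop. 4.1] -/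
theorem exists_analytification_free (hX : IsSmoothProjective n X) :
    ∃ (r : ℕ) (E : ComplexVectorBundle.{0, 0} (ComplexPoints X))
      (α : ∀ U : X.left.Opens, Γ((SheafOfModules.free (R := X.left.ringCatSheaf) I : X.left.Modules), U) →
        ∀ P : ComplexPoints X, E.E P),
      r = Nat.card I ∧ E.rank = r ∧
      (∀ x : X.left, ∃ (U : X.left.Opens) (s : Fin r → Γ((SheafOfModules.free (R := X.left.ringCatSheaf) I :
        X.left.Modules), U)), x ∈ U ∧ IsSectionFrame (SheafOfModules.free (R := X.left.ringCatSheaf) I : X.left.Modules) U s) ∧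
      (∀ (U : X.left.Opens) (σ : Γ((SheafOfModules.free (R := X.left.ringCatSheaf) I : X.left.Modules), U)),
        ContinuousOn (fun P ↦ (⟨P, α U σ P⟩ : TotalSpace E.F E.E)) {P | P.pt ∈ U}) ∧
      (theChernClassTheory.topologicalChernCharacter ℂ E 0 : complexBetti X (2 * 0)) =
        (Nat.card I : ℂ) • singularCohomology.one ℂ (ComplexPoints X) ∧
      (∀ k : ℕ, 0 < k → (theChernClassTheory.topologicalChernCharacter ℂ E k : complexBetti X (2 * k)) = 0) ∧
      (∀ i : ℕ, 0 < i → chernClassZ E i = 0) := by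
  haveI := IsSmoothProjective.isIntegral_holds hX
  obtain ⟨r, E, α, hrank, hfr, hadd, hsmul, hres, hcont, hframe⟩ :=
    exists_topologicalAnalytification_of_isVectorBundle hX
      (isVectorBundle_free (X := X.left) I : IsVectorBundle (SheafOfModules.free (R := X.left.ringCatSheaf) I))
  refine ⟨r, E, α, ?_, hrank, hfr, hcont,
    topologicalChernCharacter_zero_of_comparison_free hX E hrank hfr,
    fun k hk ↦ topologicalChernCharacter_eq_zero_of_comparison_free hX E α hrank hfr hcont hframe hk,
    fun i hi ↦ chernClassZ_eq_zero_of_comparison_free hX E α hfr hcont hframe hi⟩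
  rw [frameSize_eq_card_of_comparison_free hfr, Nat.card_eq_fintype_card]

end Summit.HodgeConjecture.HodgeConjecture.Theorems

end
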